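import Mathlib
import HarnessLib
import Literature.Analysis.FluidPDE.TypeIAncientMildRescale
import Literature.Analysis.FluidPDE.CylinderInversion
import Summits.NavierStokesRegularity.NavierStokesRegularity.Theorems.FilamentPinchDoorFilamentPinchLiouvilleFarFieldFlux
import Summits.NavierStokesRegularity.NavierStokesRegularity.Theorems.HalfSpaceWindowDoorCirculationCarryingRigidityAngularMeanDrift
import Summits.NavierStokesRegularity.NavierStokesRegularity.Theorems.HalfSpaceWindowDoorCirculationCarryingRigidityConeFluxSubsolution

/-!
# Route `HalfSpaceWindowDoor`, crux `CirculationCarryingRigidity` (stmt-NavierStokesRegularity-25311) — line `eddy_covariance`,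
# MOVING FRAME: the circle law about a vertical axis displaced along a similarity ray `x_h = √(−t)·y₀`

LEAD ns-hsw-p1 g10, `--supports 25311 --as helper`; card `Cruxes/…/Lines/eddy_covariance.md`.

All record / sweeping / eddy theorems of this line are stated about ONE vertical axis.  By translation invariance of the door class
(`inDoorClass_translate`, `signE3_translate`) they hold about every FIXED vertical axis; but in similarity variables every fixed axis
collapses onto the central one as `t → −∞`.  The axes that stay put in similarity variables are the MOVING ones, `x_h = a(t) = √(−t)·y₀`.
The door class is not invariant under this time-dependent change of frame (the Oseen gauge pins the frame), so the moving profile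
`W(t,x) = v(t, x + √(−t)y₀)` is NOT a door-class profile; but each SLICE of it is a slice of the door-class translate `v(·, · + √(−t)y₀)`,
and its circulation obeys the fixed-axis circle law with ONE extra term, the flux swept by the moving circle:
* `deriv_moving_point` — `∂_τ[v(τ, y + √(−τ)y₀)] = (∂_τ v)(s, y + c) + Dv(s)(y + c)[ȧ]`, `c = √(−s)y₀`, `ȧ = −y₀/(2√(−s))`;
* `integral_inner_fderiv_eT` — for a `C¹` slice `u` and a constant vector `b`:
  `∮_{S(r,z)} ⟪Du·b, e_θ⟫ dl = ∫₀^{2π} (ω₃⟪b, e_r⟫ − b₂ ω_r) r dθ` (from `⟪Du b, e_θ⟫ − ⟪Du e_θ, b⟫ = ⟪ω, b × e_θ⟫` and `∮∂_θ⟪u, b⟫ = 0`),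
  hence `≤ ‖b‖(∮ω₃ dl + |∮ω_r dl|)` when `ω₃ ≥ 0` (`integral_inner_fderiv_eT_le`);
* `deriv_circ_moving` / `deriv_circ_moving_eq_remainder` — the circle law for `W`:
  `∂ₛΓ_W = Γ_rr − Γ_r/r + Γ_zz + ℛ − v̄_rΓ_r + v̄_z∮ω_r dl + 𝒳`, all slice quantities those of `W(s)`, with the MOVING FLUX
  `𝒳 ≤ (‖y₀‖/2)/√(−s)·(∮ω₃ dl + |∮ω_r dl|)` (`movingFlux_le`) — of exactly the shape the eddy barrier absorbs in its drift;
* bookkeeping for the barrier run with `W`: `isSmoothSpaceTimeOn_moving`, `tube_le_moving` / `tube_bddAbove_moving`,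
  `continuousOn_comparison_of_smooth`.
WHAT THIS IS NOT: not about NS regularity; HYPOTHETICAL blow-up profiles (KNSS ancient mild solutions).  No item is closed here.
-/

noncomputable section

-- the summit and its single sub-problem share the name (CONVENTIONS §1), as in every Theorems file
set_option linter.dupNamespace false

namespace Summit.NavierStokesRegularity.NavierStokesRegularity.Theorems.HalfSpaceWindowDoorCirculationCarryingRigidityMovingFrame

open MeasureTheory Set Function Filter Topology InnerProductSpace
open scoped RealInnerProductSpace InnerProductSpace ContDiff
open Literature.Analysis Literature.Analysis.UnboundedOperators
open Literature.Analysis.FluidPDE hiding eR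
open Summit.NavierStokesRegularity.NavierStokesRegularity.Theorems.HalfSpaceWindowDoorCirculationCarryingRigidityDefs
  (InDoorClass SignE3)
open Summit.NavierStokesRegularity.NavierStokesRegularity.Theorems.AxisTwistDoorAveragedConeLiouvilleDefs
  (cylPt eT eR e3 circ vortCirc radVortCirc meanR meanZ remainder)
open Summit.NavierStokesRegularity.NavierStokesRegularity.Theorems.AveragedConeLiouville.CircleStokes
  (cylPt_two_pi continuous_eT continuous_eR inner_e3 contDiff_eT)
open Summit.NavierStokesRegularity.NavierStokesRegularity.Theorems.AxisTwistDoorAveragedConeLiouvilleCylFrame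
  (inner_eR inner_eT norm_eR norm_eT hasDerivAt_slice_comp_cylPt_θ continuous_cylPt_θ)
open Summit.NavierStokesRegularity.NavierStokesRegularity.Theorems.AveragedConeLiouville.CircleSwirl (hasDerivAt_circ_s)
open Summit.NavierStokesRegularity.NavierStokesRegularity.Theorems.HalfSpaceWindowDoorCirculationCarryingRigidityAxisCirculation
  (isSmoothSpaceTimeOn_circF isSmoothSpaceTimeOn_of_class)
open Summit.NavierStokesRegularity.NavierStokesRegularity.Theorems.HalfSpaceWindowDoorCirculationCarryingRigidityAngularMeanDrift
  (deriv_circ_s_eq_remainder)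
open Summit.NavierStokesRegularity.NavierStokesRegularity.Theorems.FilamentPinchDoorFilamentPinchLiouvilleFarFieldFlux
  (curl_comp_add_right)
open Summit.NavierStokesRegularity.NavierStokesRegularity.Theorems.PoloidalWindowDoorPoloidalWindowRigidityWindow
  (isTypeIAncientMild_of_class)
open Summit.NavierStokesRegularity.NavierStokesRegularity.Theorems.HalfSpaceWindowDoorCirculationCarryingRigidityConeFluxSubsolution
  (circ_le_linear contDiff_one_slice)

variable {C : ℝ} {v : ℝ → EuclideanSpace ℝ (Fin 3) → EuclideanSpace ℝ (Fin 3)}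

/-! ### Translation invariance of the door class -/

/-- The door class is invariant under a fixed spatial translation `x ↦ x + c`. -/
theorem inDoorClass_translate (hv : InDoorClass C v) (c : EuclideanSpace ℝ (Fin 3)) :
    InDoorClass C (fun s x => v s (x + c)) := by
  have h := (isTypeIAncientMild_of_class hv.1 hv.2.1 hv.2.2.1 hv.2.2.2).comp_add_right c
  exact ⟨h.hasTypeITimeDecay, h.continuousOn_uncurry, fun _ _ hst ht x => h.mild_eq_heatExtension hst ht x,
    fun _ ht => h.isDivFree ht⟩

/-- The closed-hemisphere sign condition is invariant under a fixed spatial translation. -/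
theorem signE3_translate (hsign : SignE3 v) (c : EuclideanSpace ℝ (Fin 3)) : SignE3 (fun s x => v s (x + c)) := by
  intro s hs y
  have h := hsign s hs (y + c)
  have e : curl (fun x => v s (x + c)) y = curl (v s) (y + c) := curl_comp_add_right (v s) c y
  simpa only [e] using h

/-! ### Slice calculus: the azimuthal flux of `Du·b` around a circle -/

section Slice

variable {u : EuclideanSpace ℝ (Fin 3) → EuclideanSpace ℝ (Fin 3)}

/-- `∮ ∂_θ⟪u, b⟫ = 0`: `∫₀^{2π} ⟪Du(cylPt r θ z)(r e_θ), b⟫ dθ = 0` for a `C¹` slice and a constant vector `b`. -/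
theorem integral_inner_fderiv_tangent (hu : ContDiff ℝ 1 u) (b : EuclideanSpace ℝ (Fin 3)) (r z : ℝ) :
    ∫ θ in (0 : ℝ)..(2 * Real.pi), ⟪fderiv ℝ u (cylPt r θ z) (r • eT θ), b⟫_ℝ = 0 := by
  have hd : Differentiable ℝ u := hu.differentiable one_ne_zero
  have hderiv : ∀ θ : ℝ, HasDerivAt (fun θ' => ⟪u (cylPt r θ' z), b⟫_ℝ)
      ⟪fderiv ℝ u (cylPt r θ z) (r • eT θ), b⟫_ℝ θ := by
    intro θ
    have h := (hasDerivAt_slice_comp_cylPt_θ hd r θ z).inner ℝ (hasDerivAt_const θ b)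
    simpa using h
  have hcont : Continuous fun θ => ⟪fderiv ℝ u (cylPt r θ z) (r • eT θ), b⟫_ℝ := by
    have hD : Continuous (fderiv ℝ u) := hu.continuous_fderiv one_ne_zero
    have h1 : Continuous fun θ => fderiv ℝ u (cylPt r θ z) (r • eT θ) :=
      (hD.comp (continuous_cylPt_θ r z)).clm_apply (continuous_eT.const_smul r)
    exact h1.inner continuous_const
  rw [intervalIntegral.integral_eq_sub_of_hasDerivAt (fun θ _ => hderiv θ) (hcont.intervalIntegrable _ _),
    cylPt_two_pi, sub_self]

/-- Pointwise: `⟪Du b, e_θ⟫ = ⟪Du e_θ, b⟫ + ω₃⟪b, e_r⟫ − b₂ ω_r` (`ω = curl u`; from `⟪Du α, β⟫ − ⟪Du β, α⟫ = ⟪ω, α × β⟩`). -/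
theorem inner_fderiv_eT_eq (u : EuclideanSpace ℝ (Fin 3) → EuclideanSpace ℝ (Fin 3)) (y b : EuclideanSpace ℝ (Fin 3)) (θ : ℝ) :
    ⟪fderiv ℝ u y b, eT θ⟫_ℝ = ⟪fderiv ℝ u y (eT θ), b⟫_ℝ
      + ⟪curl u y, e3⟫_ℝ * ⟪b, eR θ⟫_ℝ - b 2 * ⟪curl u y, eR θ⟫_ℝ := by
  have h := inner_fderiv_sub_inner_fderiv_eq_curl (v := u) (p := y) b (eT θ)
  have hT0 : eT θ 0 = -Real.sin θ := by simp [eT]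
  have hT1 : eT θ 1 = Real.cos θ := by simp [eT]
  have hT2 : eT θ 2 = 0 := by simp [eT]
  rw [hT0, hT1, hT2] at h
  rw [inner_e3, inner_eR, inner_eR]
  linear_combination h

/-- **The flux swept by a translated circle.**  For a `C¹` slice `u` and a constant vector `b`:
`∫₀^{2π} ⟪Du(cylPt r θ z) b, e_θ⟫ r dθ = ∫₀^{2π} (ω₃ ⟪b, e_r⟫ − b₂ ω_r) r dθ`. -/
theorem integral_inner_fderiv_eT (hu : ContDiff ℝ 1 u) (b : EuclideanSpace ℝ (Fin 3)) (r z : ℝ) :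
    ∫ θ in (0 : ℝ)..(2 * Real.pi), ⟪fderiv ℝ u (cylPt r θ z) b, eT θ⟫_ℝ * r =
      ∫ θ in (0 : ℝ)..(2 * Real.pi),
        (⟪curl u (cylPt r θ z), e3⟫_ℝ * ⟪b, eR θ⟫_ℝ - b 2 * ⟪curl u (cylPt r θ z), eR θ⟫_ℝ) * r := by
  have hD : Continuous (fderiv ℝ u) := hu.continuous_fderiv one_ne_zero
  have hω : Continuous fun θ => curl u (cylPt r θ z) := (continuous_curl hu).comp (continuous_cylPt_θ r z)
  have h1c : Continuous fun θ => ⟪fderiv ℝ u (cylPt r θ z) (r • eT θ), b⟫_ℝ :=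
    ((hD.comp (continuous_cylPt_θ r z)).clm_apply (continuous_eT.const_smul r)).inner continuous_const
  have h2c : Continuous fun θ =>
      (⟪curl u (cylPt r θ z), e3⟫_ℝ * ⟪b, eR θ⟫_ℝ - b 2 * ⟪curl u (cylPt r θ z), eR θ⟫_ℝ) * r :=
    (((hω.inner continuous_const).mul (continuous_const.inner continuous_eR)).sub
      (continuous_const.mul (hω.inner continuous_eR))).mul continuous_const
  have hpt : ∀ θ : ℝ, ⟪fderiv ℝ u (cylPt r θ z) b, eT θ⟫_ℝ * r =
      ⟪fderiv ℝ u (cylPt r θ z) (r • eT θ), b⟫_ℝ +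
        (⟪curl u (cylPt r θ z), e3⟫_ℝ * ⟪b, eR θ⟫_ℝ - b 2 * ⟪curl u (cylPt r θ z), eR θ⟫_ℝ) * r := by
    intro θ
    rw [inner_fderiv_eT_eq, map_smul, real_inner_smul_left]
    ring
  simp_rw [hpt]
  rw [intervalIntegral.integral_add (h1c.intervalIntegrable _ _) (h2c.intervalIntegrable _ _),
    integral_inner_fderiv_tangent hu b r z, zero_add]

/-- **Bound on the swept flux** when `ω₃ ≥ 0`: `∫₀^{2π} ⟪Du b, e_θ⟫ r dθ ≤ ‖b‖ (∮ω₃ dl + |∮ω_r dl|)` (`r ≥ 0`). -/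
theorem integral_inner_fderiv_eT_le (hu : ContDiff ℝ 1 u) (hω : ∀ y, 0 ≤ ⟪curl u y, e3⟫_ℝ)
    (b : EuclideanSpace ℝ (Fin 3)) {r : ℝ} (hr : 0 ≤ r) (z : ℝ) :
    ∫ θ in (0 : ℝ)..(2 * Real.pi), ⟪fderiv ℝ u (cylPt r θ z) b, eT θ⟫_ℝ * r ≤
      ‖b‖ * ((∫ θ in (0 : ℝ)..(2 * Real.pi), ⟪curl u (cylPt r θ z), e3⟫_ℝ * r) +
        |∫ θ in (0 : ℝ)..(2 * Real.pi), ⟪curl u (cylPt r θ z), eR θ⟫_ℝ * r|) := by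
  rw [integral_inner_fderiv_eT hu b r z]
  have hωc : Continuous fun θ => curl u (cylPt r θ z) := (continuous_curl hu).comp (continuous_cylPt_θ r z)
  have hPc : Continuous fun θ => ⟪curl u (cylPt r θ z), e3⟫_ℝ * ⟪b, eR θ⟫_ℝ * r :=
    ((hωc.inner continuous_const).mul (continuous_const.inner continuous_eR)).mul continuous_const
  have hQc : Continuous fun θ => ⟪curl u (cylPt r θ z), eR θ⟫_ℝ * r := (hωc.inner continuous_eR).mul continuous_const
  have h3c : Continuous fun θ => ⟪curl u (cylPt r θ z), e3⟫_ℝ * r := (hωc.inner continuous_const).mul continuous_const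
  have hsplit : ∀ θ : ℝ, (⟪curl u (cylPt r θ z), e3⟫_ℝ * ⟪b, eR θ⟫_ℝ - b 2 * ⟪curl u (cylPt r θ z), eR θ⟫_ℝ) * r =
      ⟪curl u (cylPt r θ z), e3⟫_ℝ * ⟪b, eR θ⟫_ℝ * r - b 2 * (⟪curl u (cylPt r θ z), eR θ⟫_ℝ * r) := fun θ => by ring
  simp_rw [hsplit]
  rw [intervalIntegral.integral_sub (hPc.intervalIntegrable _ _) ((hQc.intervalIntegrable _ _).const_mul _),
    intervalIntegral.integral_const_mul]
  -- first piece: `ω₃ ⟪b, e_r⟫ r ≤ ω₃ ‖b‖ r`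
  have hP : ∫ θ in (0 : ℝ)..(2 * Real.pi), ⟪curl u (cylPt r θ z), e3⟫_ℝ * ⟪b, eR θ⟫_ℝ * r ≤
      ‖b‖ * ∫ θ in (0 : ℝ)..(2 * Real.pi), ⟪curl u (cylPt r θ z), e3⟫_ℝ * r := by
    rw [← intervalIntegral.integral_const_mul]
    refine intervalIntegral.integral_mono_on (by positivity) (hPc.intervalIntegrable _ _)
      ((h3c.intervalIntegrable _ _).const_mul _) fun θ _ => ?_
    have hbe : ⟪b, eR θ⟫_ℝ ≤ ‖b‖ := by
      have h := real_inner_le_norm b (eR θ)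
      rwa [norm_eR, mul_one] at h
    have hω0 : 0 ≤ ⟪curl u (cylPt r θ z), e3⟫_ℝ * r := mul_nonneg (hω _) hr
    nlinarith
  -- second piece: `−b₂ R ≤ ‖b‖ |R|`
  have hb2 : |b 2| ≤ ‖b‖ := by
    have h := PiLp.norm_apply_le (p := 2) b 2
    rwa [Real.norm_eq_abs] at h
  have hQ : -(b 2 * ∫ θ in (0 : ℝ)..(2 * Real.pi), ⟪curl u (cylPt r θ z), eR θ⟫_ℝ * r) ≤
      ‖b‖ * |∫ θ in (0 : ℝ)..(2 * Real.pi), ⟪curl u (cylPt r θ z), eR θ⟫_ℝ * r| := by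
    set R := ∫ θ in (0 : ℝ)..(2 * Real.pi), ⟪curl u (cylPt r θ z), eR θ⟫_ℝ * r
    have h1 : -(b 2 * R) ≤ |b 2 * R| := neg_le_abs _
    rw [abs_mul] at h1
    exact h1.trans (mul_le_mul_of_nonneg_right hb2 (abs_nonneg _))
  linarith

end Slice

/-! ### The moving frame `W(t,x) = v(t, x + √(−t)·y₀)` -/

/-- The moving profile is jointly smooth on the open lower slab whenever `v` is. -/
theorem isSmoothSpaceTimeOn_moving (hsm : IsSmoothSpaceTimeOn (Iio (0 : ℝ)) v) (y₀ : EuclideanSpace ℝ (Fin 3)) :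
    IsSmoothSpaceTimeOn (Iio (0 : ℝ)) (fun s x => v s (x + Real.sqrt (-s) • y₀)) := by
  have hΦ : ContDiffOn ℝ ∞ (fun p : ℝ × EuclideanSpace ℝ (Fin 3) =>
      ((p.1, p.2 + Real.sqrt (-p.1) • y₀) : ℝ × EuclideanSpace ℝ (Fin 3))) (Iio (0 : ℝ) ×ˢ univ) := by
    refine contDiffOn_fst.prodMk (contDiffOn_snd.add ((contDiffOn_fst.neg.sqrt fun p hp => ?_).smul contDiffOn_const))
    have h : p.1 < 0 := (mem_prod.1 hp).1
    exact (neg_pos.2 h).ne'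
  have hmaps : MapsTo (fun p : ℝ × EuclideanSpace ℝ (Fin 3) =>
      ((p.1, p.2 + Real.sqrt (-p.1) • y₀) : ℝ × EuclideanSpace ℝ (Fin 3))) (Iio (0 : ℝ) ×ˢ univ) (Iio (0 : ℝ) ×ˢ univ) :=
    fun p hp => ⟨(mem_prod.1 hp).1, mem_univ _⟩
  exact hsm.comp hΦ hmaps

/-- **Velocity of a point riding the moving frame**: `∂_τ[v(τ, y + √(−τ)y₀)](s) = (∂_τ v)(s, y + c) + Dv(s)(y + c)[ȧ]`,
`c = √(−s)·y₀`, `ȧ = −y₀/(2√(−s))`. -/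
theorem hasDerivAt_moving_point (hsm : IsSmoothSpaceTimeOn (Iio (0 : ℝ)) v) {s : ℝ} (hs : s < 0)
    (y y₀ : EuclideanSpace ℝ (Fin 3)) :
    HasDerivAt (fun τ => v τ (y + Real.sqrt (-τ) • y₀))
      (deriv (fun τ => v τ (y + Real.sqrt (-s) • y₀)) s +
        fderiv ℝ (v s) (y + Real.sqrt (-s) • y₀) ((-1 / (2 * Real.sqrt (-s))) • y₀)) s := by
  set c : EuclideanSpace ℝ (Fin 3) := Real.sqrt (-s) • y₀ with hc
  have hG : DifferentiableAt ℝ (uncurry v) (s, y + c) :=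
    (hsm.contDiffAt isOpen_Iio hs _).differentiableAt (by simp)
  have hsq : HasDerivAt (fun τ : ℝ => Real.sqrt (-τ)) (-1 / (2 * Real.sqrt (-s))) s := by
    have h := (hasDerivAt_neg s).sqrt (neg_pos.2 hs).ne'
    simpa using h
  have hγ : HasDerivAt (fun τ : ℝ => ((τ, y + Real.sqrt (-τ) • y₀) : ℝ × EuclideanSpace ℝ (Fin 3)))
      ((1 : ℝ), (-1 / (2 * Real.sqrt (-s))) • y₀) s :=
    (hasDerivAt_id s).prodMk ((hsq.smul_const y₀).const_add y)
  have hcomp := hG.hasFDerivAt.comp_hasDerivAt s hγ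
  have e1 : fderiv ℝ (uncurry v) (s, y + c) ((1 : ℝ), (-1 / (2 * Real.sqrt (-s))) • y₀) =
      fderiv ℝ (uncurry v) (s, y + c) (1, 0) + fderiv ℝ (uncurry v) (s, y + c) (0, (-1 / (2 * Real.sqrt (-s))) • y₀) := by
    rw [← map_add, Prod.mk_add_mk, add_zero, zero_add]
  rw [e1, ← hsm.deriv_timeLine isOpen_Iio hs (y + c), ← hsm.fderiv_slice_apply_of_isOpen isOpen_Iio hs (y + c)] at hcomp
  exact hcomp

/-- **The circle law in the moving frame, raw form**: `∂ₛΓ_W(r,z,s) = ∂ₛΓ_{v(·,·+c)}(r,z,s) + 𝒳`, `c = √(−s)y₀`, with the moving flux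
`𝒳 = ∫₀^{2π} ⟪D(W s)(cylPt r θ z)[ȧ], e_θ⟫ r dθ`, `ȧ = −y₀/(2√(−s))`. -/
theorem deriv_circ_moving (hv : InDoorClass C v) (y₀ : EuclideanSpace ℝ (Fin 3)) {s : ℝ} (hs : s < 0) (r z : ℝ) :
    deriv (fun σ => circ (fun τ x => v τ (x + Real.sqrt (-τ) • y₀)) r z σ) s =
      deriv (fun σ => circ (fun τ x => v τ (x + Real.sqrt (-s) • y₀)) r z σ) s +
        ∫ θ in (0 : ℝ)..(2 * Real.pi),
          ⟪fderiv ℝ (fun x => v s (x + Real.sqrt (-s) • y₀)) (cylPt r θ z) ((-1 / (2 * Real.sqrt (-s))) • y₀), eT θ⟫_ℝ * r := by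
  set c : EuclideanSpace ℝ (Fin 3) := Real.sqrt (-s) • y₀ with hc
  set a : EuclideanSpace ℝ (Fin 3) := (-1 / (2 * Real.sqrt (-s))) • y₀ with ha
  have hsm := isSmoothSpaceTimeOn_of_class hv.1 hv.2.1 hv.2.2.1 hv.2.2.2
  have hsmW := isSmoothSpaceTimeOn_moving hsm y₀
  have hwc := inDoorClass_translate hv c
  have hsmc := isSmoothSpaceTimeOn_of_class hwc.1 hwc.2.1 hwc.2.2.1 hwc.2.2.2
  have h1 := hasDerivAt_circ_s isOpen_Iio hsmW hs r z
  have h2 := hasDerivAt_circ_s isOpen_Iio hsmc hs r z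
  rw [h1.deriv, h2.deriv]
  -- pointwise splitting of the time derivative along the moving circle
  have hpt : ∀ θ : ℝ, deriv (fun τ => v τ (cylPt r θ z + Real.sqrt (-τ) • y₀)) s =
      deriv (fun τ => v τ (cylPt r θ z + c)) s + fderiv ℝ (v s) (cylPt r θ z + c) a := fun θ =>
    (hasDerivAt_moving_point hsm hs (cylPt r θ z) y₀).deriv
  have hshift : ∀ θ : ℝ, fderiv ℝ (fun x => v s (x + c)) (cylPt r θ z) a = fderiv ℝ (v s) (cylPt r θ z + c) a := fun θ => by
    rw [fderiv_comp_add_right]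
  -- continuity of the two pieces
  have hD1c : Continuous fun θ => ⟪deriv (fun τ => v τ (cylPt r θ z + c)) s, eT θ⟫_ℝ * r := by
    have hd := (hsmc.isSmoothSpaceTimeOn_deriv isOpen_Iio).contDiff_slice (t := s) hs
    have hdc : Continuous fun y : EuclideanSpace ℝ (Fin 3) => deriv (fun τ => v τ (y + c)) s := hd.continuous
    exact ((hdc.comp (continuous_cylPt_θ r z)).inner continuous_eT).mul continuous_const
  have hD2c : Continuous fun θ => ⟪fderiv ℝ (v s) (cylPt r θ z + c) a, eT θ⟫_ℝ * r := by
    have h1s : ContDiff ℝ 1 (v s) := contDiff_one_slice hv hs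
    have hD : Continuous (fderiv ℝ (v s)) := h1s.continuous_fderiv one_ne_zero
    exact (((hD.comp ((continuous_cylPt_θ r z).add continuous_const)).clm_apply continuous_const).inner
      continuous_eT).mul continuous_const
  have hsum : ∀ θ : ℝ, ⟪deriv (fun τ => v τ (cylPt r θ z + Real.sqrt (-τ) • y₀)) s, eT θ⟫_ℝ * r =
      ⟪deriv (fun τ => v τ (cylPt r θ z + c)) s, eT θ⟫_ℝ * r + ⟪fderiv ℝ (v s) (cylPt r θ z + c) a, eT θ⟫_ℝ * r := by
    intro θ; rw [hpt θ, inner_add_left, add_mul]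
  simp_rw [hshift]
  show (∫ θ in (0 : ℝ)..(2 * Real.pi), ⟪deriv (fun τ => v τ (cylPt r θ z + Real.sqrt (-τ) • y₀)) s, eT θ⟫_ℝ * r) =
    (∫ θ in (0 : ℝ)..(2 * Real.pi), ⟪deriv (fun τ => v τ (cylPt r θ z + c)) s, eT θ⟫_ℝ * r) +
      ∫ θ in (0 : ℝ)..(2 * Real.pi), ⟪fderiv ℝ (v s) (cylPt r θ z + c) a, eT θ⟫_ℝ * r
  simp_rw [hsum]
  exact intervalIntegral.integral_add (hD1c.intervalIntegrable _ _) (hD2c.intervalIntegrable _ _)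

/-- **The moving flux is of eddy-bound shape**: `𝒳 ≤ (‖y₀‖/(2√(−s)))·(∮ω₃ dl + |∮ω_r dl|)` on every circle about the moving axis
(`ω₃ ≥ 0`, `r ≥ 0`; the vorticity integrals are those of the slice `W(s) = v(s, · + √(−s)y₀)`). -/
theorem movingFlux_le (hv : InDoorClass C v) (hsign : SignE3 v) (y₀ : EuclideanSpace ℝ (Fin 3)) {s : ℝ} (hs : s < 0)
    {r : ℝ} (hr : 0 ≤ r) (z : ℝ) :
    ∫ θ in (0 : ℝ)..(2 * Real.pi),
        ⟪fderiv ℝ (fun x => v s (x + Real.sqrt (-s) • y₀)) (cylPt r θ z) ((-1 / (2 * Real.sqrt (-s))) • y₀), eT θ⟫_ℝ * r ≤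
      ‖y₀‖ / (2 * Real.sqrt (-s)) *
        (vortCirc (fun τ x => v τ (x + Real.sqrt (-τ) • y₀)) r z s +
          |radVortCirc (fun τ x => v τ (x + Real.sqrt (-τ) • y₀)) r z s|) := by
  set c : EuclideanSpace ℝ (Fin 3) := Real.sqrt (-s) • y₀ with hc
  have hwc := inDoorClass_translate hv c
  have hsc := signE3_translate hsign c
  have h1 : ContDiff ℝ 1 (fun x => v s (x + c)) := contDiff_one_slice hwc hs
  have hω : ∀ y, 0 ≤ ⟪curl (fun x => v s (x + c)) y, e3⟫_ℝ := fun y => hsc s hs y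
  have h := integral_inner_fderiv_eT_le h1 hω ((-1 / (2 * Real.sqrt (-s))) • y₀) hr z
  have hsq : 0 < Real.sqrt (-s) := Real.sqrt_pos.2 (neg_pos.2 hs)
  have hnorm : ‖((-1 / (2 * Real.sqrt (-s))) • y₀ : EuclideanSpace ℝ (Fin 3))‖ = ‖y₀‖ / (2 * Real.sqrt (-s)) := by
    rw [norm_smul, Real.norm_eq_abs, abs_div, abs_neg, abs_one, abs_of_pos (by positivity : (0:ℝ) < 2 * Real.sqrt (-s))]
    ring
  rw [hnorm] at h
  exact h

/-- **THE CIRCLE LAW IN THE MOVING FRAME** (remainder form): for a door-class `v`, `y₀ ∈ ℝ³`, `s < 0`, `r > 0`, with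
`W(τ,x) = v(τ, x + √(−τ)y₀)`:
`∂ₛΓ_W = ∂ᵣᵣΓ_W − r⁻¹∂ᵣΓ_W + ∂_zzΓ_W + ℛ_W − v̄_r ∮ω₃ dl + v̄_z ∮ω_r dl + 𝒳`, every slice quantity on the right being that of
`W(s)`, and `𝒳` the moving flux of `deriv_circ_moving` (bounded by `movingFlux_le`). -/
theorem deriv_circ_moving_eq_remainder (hv : InDoorClass C v) (y₀ : EuclideanSpace ℝ (Fin 3)) {s : ℝ} (hs : s < 0)
    {r : ℝ} (hr : 0 < r) (z : ℝ) :
    deriv (fun σ => circ (fun τ x => v τ (x + Real.sqrt (-τ) • y₀)) r z σ) s =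
      deriv (fun r' => deriv (fun r'' => circ (fun τ x => v τ (x + Real.sqrt (-τ) • y₀)) r'' z s) r') r
        - r⁻¹ * deriv (fun r' => circ (fun τ x => v τ (x + Real.sqrt (-τ) • y₀)) r' z s) r
        + deriv (fun z' => deriv (fun z'' => circ (fun τ x => v τ (x + Real.sqrt (-τ) • y₀)) r z'' s) z') z
        + remainder (fun τ x => v τ (x + Real.sqrt (-τ) • y₀)) r z s
        - meanR (fun τ x => v τ (x + Real.sqrt (-τ) • y₀)) r z s * vortCirc (fun τ x => v τ (x + Real.sqrt (-τ) • y₀)) r z s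
        + meanZ (fun τ x => v τ (x + Real.sqrt (-τ) • y₀)) r z s * radVortCirc (fun τ x => v τ (x + Real.sqrt (-τ) • y₀)) r z s
        + ∫ θ in (0 : ℝ)..(2 * Real.pi),
          ⟪fderiv ℝ (fun x => v s (x + Real.sqrt (-s) • y₀)) (cylPt r θ z) ((-1 / (2 * Real.sqrt (-s))) • y₀), eT θ⟫_ℝ * r := by
  have hwc := inDoorClass_translate hv (Real.sqrt (-s) • y₀)
  have hlaw := deriv_circ_s_eq_remainder hwc.1 hwc.2.1 hwc.2.2.1 hwc.2.2.2 hs hr z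
  rw [deriv_circ_moving hv y₀ hs r z, hlaw]
  rfl

/-! ### Bookkeeping for the barrier run in the moving frame -/

/-- Stokes bound on the tube circulations of the moving profile: `Γ_W(R₁√(−s'), z', s') ≤ 2πR₁C`. -/
theorem tube_le_moving (hv : InDoorClass C v) (y₀ : EuclideanSpace ℝ (Fin 3)) {R₁ : ℝ} (hR₁ : 0 ≤ R₁) {s' : ℝ} (hs' : s' < 0)
    (z' : ℝ) : circ (fun τ x => v τ (x + Real.sqrt (-τ) • y₀)) (R₁ * Real.sqrt (-s')) z' s' ≤ 2 * Real.pi * R₁ * C := by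
  have hwc := inDoorClass_translate hv (Real.sqrt (-s') • y₀)
  have hsq : 0 < Real.sqrt (-s') := Real.sqrt_pos.2 (neg_pos.2 hs')
  have h := circ_le_linear hwc hs' (mul_nonneg hR₁ hsq.le) z'
  calc circ (fun τ x => v τ (x + Real.sqrt (-τ) • y₀)) (R₁ * Real.sqrt (-s')) z' s'
      = circ (fun τ x => v τ (x + Real.sqrt (-s') • y₀)) (R₁ * Real.sqrt (-s')) z' s' := rfl
    _ ≤ 2 * Real.pi * (R₁ * Real.sqrt (-s')) * (C / Real.sqrt (-s')) := h
    _ = 2 * Real.pi * R₁ * C := by field_simp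

/-- The running tube maximum of the moving profile is bounded (by `2πR₁C`). -/
theorem tube_bddAbove_moving (hv : InDoorClass C v) (y₀ : EuclideanSpace ℝ (Fin 3)) {R₁ : ℝ} (hR₁ : 0 ≤ R₁) {s₁ : ℝ}
    (hs₁ : s₁ < 0) :
    BddAbove {m : ℝ | ∃ s' : ℝ, s' ≤ s₁ ∧ ∃ z' : ℝ,
        m = circ (fun τ x => v τ (x + Real.sqrt (-τ) • y₀)) (R₁ * Real.sqrt (-s')) z' s'} ∧
      ∀ m ∈ {m : ℝ | ∃ s' : ℝ, s' ≤ s₁ ∧ ∃ z' : ℝ,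
        m = circ (fun τ x => v τ (x + Real.sqrt (-τ) • y₀)) (R₁ * Real.sqrt (-s')) z' s'}, m ≤ 2 * Real.pi * R₁ * C := by
  have key : ∀ m ∈ {m : ℝ | ∃ s' : ℝ, s' ≤ s₁ ∧ ∃ z' : ℝ,
      m = circ (fun τ x => v τ (x + Real.sqrt (-τ) • y₀)) (R₁ * Real.sqrt (-s')) z' s'}, m ≤ 2 * Real.pi * R₁ * C := by
    rintro m ⟨s', hs', z', rfl⟩
    exact tube_le_moving hv y₀ hR₁ (lt_of_le_of_lt hs' hs₁) z'
  exact ⟨⟨2 * Real.pi * R₁ * C, key⟩, key⟩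

/-- Joint continuity of the quadratic comparison function on a closed slab, for ANY jointly smooth field (the door-class case is
`…FlatTools.continuousOn_comparison`; here it serves the moving profile). -/
theorem continuousOn_comparison_of_smooth {w : ℝ → EuclideanSpace ℝ (Fin 3) → EuclideanSpace ℝ (Fin 3)}
    (hsm : IsSmoothSpaceTimeOn (Iio (0 : ℝ)) w) {μ A s₀ s₁ : ℝ} (hs₀₁ : s₀ < s₁) (hs₁ : s₁ < 0) :
    ContinuousOn (uncurry fun (t : ℝ) (x : EuclideanSpace ℝ (Fin 3)) =>
      (2 * Real.pi)⁻¹ * circ w (cylRadius x) (x 2) t -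
        (2 * Real.pi)⁻¹ * (μ + A * (Real.sqrt (-t) * Real.sqrt (-s₀))⁻¹ * (x 0 * x 0 + x 1 * x 1))) (Icc s₀ s₁ ×ˢ univ) := by
  have hs₀ : s₀ < 0 := hs₀₁.trans hs₁
  have hsq₀ : 0 < Real.sqrt (-s₀) := Real.sqrt_pos.2 (neg_pos.2 hs₀)
  have hsmF := isSmoothSpaceTimeOn_circF hsm
  have hFc : ContinuousOn (uncurry fun (t : ℝ) (x : EuclideanSpace ℝ (Fin 3)) => (2 * Real.pi)⁻¹ * circ w (cylRadius x) (x 2) t)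
      (Icc s₀ s₁ ×ˢ univ) :=
    hsmF.continuousOn.mono (prod_mono (fun t ht => lt_of_le_of_lt ht.2 hs₁) Subset.rfl)
  have hcont_yi : ∀ i : Fin 3, Continuous fun y : EuclideanSpace ℝ (Fin 3) => y i := fun i =>
    (continuous_apply i).comp (PiLp.continuous_ofLp 2 _)
  have hQ : Continuous fun p : ℝ × EuclideanSpace ℝ (Fin 3) => p.2 0 * p.2 0 + p.2 1 * p.2 1 :=
    (((hcont_yi 0).comp continuous_snd).mul ((hcont_yi 0).comp continuous_snd)).add
      (((hcont_yi 1).comp continuous_snd).mul ((hcont_yi 1).comp continuous_snd))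
  have hinv : ContinuousOn (fun p : ℝ × EuclideanSpace ℝ (Fin 3) => (Real.sqrt (-p.1) * Real.sqrt (-s₀))⁻¹)
      (Icc s₀ s₁ ×ˢ univ) := by
    refine ContinuousOn.inv₀ ?_ fun p hp => ?_
    · exact ((Real.continuous_sqrt.comp (continuous_neg.comp continuous_fst)).mul continuous_const).continuousOn
    · have ht : p.1 < 0 := lt_of_le_of_lt (mem_prod.1 hp).1.2 hs₁
      exact mul_ne_zero (Real.sqrt_pos.2 (neg_pos.2 ht)).ne' hsq₀.ne'
  have hφc : ContinuousOn (uncurry fun (t : ℝ) (x : EuclideanSpace ℝ (Fin 3)) =>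
      (2 * Real.pi)⁻¹ * (μ + A * (Real.sqrt (-t) * Real.sqrt (-s₀))⁻¹ * (x 0 * x 0 + x 1 * x 1))) (Icc s₀ s₁ ×ˢ univ) :=
    continuousOn_const.mul (continuousOn_const.add ((continuousOn_const.mul hinv).mul hQ.continuousOn))
  exact hFc.sub hφc

/-- **Poloidality transfers back from the moving frame**: if every slice of `W` has `ω₃ ≡ 0` then so does `v`. -/
theorem inner_curl_e3_eq_zero_of_moving (y₀ : EuclideanSpace ℝ (Fin 3))
    (hW : ∀ s < 0, ∀ y, ⟪curl ((fun τ x => v τ (x + Real.sqrt (-τ) • y₀)) s) y, e3⟫_ℝ = 0) :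
    ∀ s < 0, ∀ y, ⟪curl (v s) y, e3⟫_ℝ = 0 := by
  intro s hs y
  have h := hW s hs (y - Real.sqrt (-s) • y₀)
  have e : curl ((fun τ x => v τ (x + Real.sqrt (-τ) • y₀)) s) (y - Real.sqrt (-s) • y₀) =
      curl (v s) (y - Real.sqrt (-s) • y₀ + Real.sqrt (-s) • y₀) := curl_comp_add_right (v s) _ _
  rwa [e, sub_add_cancel] at h

end Summit.NavierStokesRegularity.NavierStokesRegularity.Theorems.HalfSpaceWindowDoorCirculationCarryingRigidityMovingFrame

end
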